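import Mathlib
import Summits.Ventures.HodgeRepro2.LevelPositivity
import Summits.Ventures.HodgeRepro2.LevelBaseChange
import Summits.Ventures.HodgeRepro2.LiuOscillator
import Summits.Ventures.HodgeRepro2.T6B5Datum
import Summits.Ventures.HodgeRepro2.T6B5Hyp
import Summits.Ventures.HodgeRepro2.T6B3Hyp
import Summits.Ventures.HodgeRepro2.T6B5Main
import Summits.Ventures.HodgeRepro2.T6B5Toy
import Summits.Ventures.HodgeRepro2.T6B5OrbitHyp
import Summits.Ventures.HodgeRepro2.T6B5IsoHyp

/-!
# T6B5Toy2 — Tier 6, sub-goal B5: the non-vacuity witness for the three new displays (README §10.5(ii)(c),(d))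

On the accepted toy datum `toyModel K c χEF` of `T6B5Toy.lean` (trivial group, one class, `W = ℂ`, `M̃ = Ω = ℚ`,
`Hom = ℚ`, one isogeny class, `galOrbit = ⊤`) the three displays of `T6B5OrbitHyp.lean` / `T6B5IsoHyp.lean` hold:
* `toyModel_orbit` — the last sentence of Cor. 4.20 on the toy shape: every weight-one conjugate symplectic `μ`
  has an admissible triple (`Liu.exists_isMuAdmissibleRep` + the trivial `OneCharacter`), so every exhausting set
  has exactly one class and `d(μ, L) = 1` for every such `μ` and every level;
* `toyModel_directSum` — Thm. 4.18's isomorphism on the toy: `ℂ ⊗[ℚ] ℚ ≃ ℂ ≃ ⨁_{one class} ℂ`, equivariant for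
  the trivial group;
* `toyModel_numberField` — `ℚ` is a number field.
`exists_model2` records that the EIGHT displays B5 now consumes (the five of `T6B5Toy.exists_model` and these
three) are jointly satisfiable, so none is refutable from the others, none is closed by `trivial`, and
`Hyp₁ → … → False` is not provable. README §8(d): uses an L-value-free non-vanishing device: NO.
-/

namespace Summit.Ventures.HodgeRepro2.T6.B5Toy2

open Summit.Ventures.HodgeRepro2.LevelPositivity Summit.Ventures.HodgeRepro2.ShimuraData
  Summit.Ventures.HodgeRepro2.T6.B5Datum Summit.Ventures.HodgeRepro2.T6.Hyp
  Summit.Ventures.HodgeRepro2.T6.B5Main Summit.Ventures.HodgeRepro2.T6.B5Toy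
open Module TensorProduct

universe u

variable (K : Type u) [Field K] [NumberField K] [NumberField.IsCMField K] (c : Liu.IdeleConjugation K)
  (χEF : Liu.QuadraticCharacter K c)

/-- The trivial character of `(A_E^∞)^×_1` (a `Liu.OneCharacter`): the third component of an oscillator triple
always exists. -/
noncomputable def trivialOneCharacter : Liu.OneCharacter K c where
  toFun := 1
  continuous := by
    show Continuous (fun _ => (1 : ℂˣ))
    exact continuous_const
  principal := fun _ _ => rfl

/-- Every weight-one conjugate symplectic `μ` is the first component of an admissible oscillator triple
(`e` from `Liu.exists_isMuAdmissibleRep` at a CM type of weight one for `μ`, `χ` the trivial character). -/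
theorem exists_admissible_triple (μ : Liu.AutomorphicCharacter K)
    (hμ : Liu.IsWeightOneConjugateSymplectic K c χEF μ) :
    ∃ t : Liu.OscillatorTriple K c χEF, t.μ = μ ∧ Liu.OscillatorTriple.IsAdmissible K t := by
  obtain ⟨Φ, hΦ, hw⟩ := hμ.2
  obtain ⟨e, he⟩ := Liu.exists_isMuAdmissibleRep K hΦ
  exact ⟨⟨μ, hμ.1, e, he.1, trivialOneCharacter K c⟩, rfl, Φ, hΦ, hw, he⟩

/-- On the toy shape every exhausting set of a weight-one conjugate symplectic `μ` has `d(μ, L) = 1`: the class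
of an admissible triple has `dim ℂ^L = 1 > 0`, so it lies in the image, and the shape's classes form a
subsingleton. -/
theorem toy_liuMultiplicity_eq_one (μ : Liu.AutomorphicCharacter K)
    (hμ : Liu.IsWeightOneConjugateSymplectic K c χEF μ)
    (L : CLevel (toyModel K c χEF)) (T : Finset (Liu.OscillatorTriple K c χEF))
    (hT₂ : ∀ t : Liu.OscillatorTriple K c χEF, Liu.OscillatorTriple.IsAdmissible K t → t.μ = μ →
      0 < (shape (toyModel K c χEF) (toyModel_hypotheses K c χEF).1 ⊤).dimInv
        ((shape (toyModel K c χEF) (toyModel_hypotheses K c χEF).1 ⊤).osc t) L →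
      (shape (toyModel K c χEF) (toyModel_hypotheses K c χEF).1 ⊤).osc t ∈
        T.image (shape (toyModel K c χEF) (toyModel_hypotheses K c χEF).1 ⊤).osc) :
    Liu.liuMultiplicity K (shape (toyModel K c χEF) (toyModel_hypotheses K c χEF).1 ⊤) T L = 1 := by
  obtain ⟨t, htμ, htadm⟩ := exists_admissible_triple K c χEF μ hμ
  have hpos : 0 < (shape (toyModel K c χEF) (toyModel_hypotheses K c χEF).1 ⊤).dimInv
      ((shape (toyModel K c χEF) (toyModel_hypotheses K c χEF).1 ⊤).osc t) L := by
    show 0 < finrank ℂ (invariants (Representation.trivial ℂ Unit ℂ) (L.1 : Subgroup Unit))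
    rw [toy_finrank_invariants_C]
    exact Nat.one_pos
  have hmem := hT₂ t htadm htμ hpos
  have hsingle : T.image (shape (toyModel K c χEF) (toyModel_hypotheses K c χEF).1 ⊤).osc =
      {(shape (toyModel K c χEF) (toyModel_hypotheses K c χEF).1 ⊤).osc t} := by
    refine Finset.eq_singleton_iff_unique_mem.mpr ⟨hmem, fun x _ => ?_⟩
    exact Subtype.ext (Subsingleton.elim _ _)
  unfold Liu.liuMultiplicity
  rw [hsingle, Finset.sum_singleton]
  show finrank ℂ (invariants (Representation.trivial ℂ Unit ℂ) (L.1 : Subgroup Unit)) = 1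
  exact toy_finrank_invariants_C _

/-- The displayed last sentence of Cor. 4.20 holds on the toy shape: both exponents are `1`. -/
theorem toyModel_orbit :
    Liu2021_Cor4_20_orbit (shape (toyModel K c χEF) (toyModel_hypotheses K c χEF).1 ⊤) := by
  intro L _ μ μ' hμ hμ' _ T T' _ hT₂ _ hT'₂
  rw [toy_liuMultiplicity_eq_one K c χEF μ hμ L T hT₂, toy_liuMultiplicity_eq_one K c χEF μ' hμ' L T' hT'₂]

/-- The index type of the direct sum of Thm. 4.18 on the toy, at a weight-one conjugate symplectic `μ`, is a
singleton (a subtype of `Unit` inhabited by the class of an admissible triple); reducible, as a class-valued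
definition, for the instance search of `toyModel_directSum`. -/
@[reducible] noncomputable def toyIdxUnique (μ : Liu.AutomorphicCharacter K)
    (hμ : Liu.IsWeightOneConjugateSymplectic K c χEF μ) :
    Unique {r : (toyModel K c χEF).Rep // ∃ t : Liu.OscillatorTriple K c χEF,
      t.μ = μ ∧ Liu.OscillatorTriple.IsAdmissible K t ∧ (toyModel K c χEF).osc t = r} where
  default := ⟨(), by
    obtain ⟨t, htμ, htadm⟩ := exists_admissible_triple K c χEF μ hμ
    exact ⟨t, htμ, htadm, rfl⟩⟩
  uniq := fun x => Subtype.ext (Subsingleton.elim _ _)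

/-- The displayed isomorphism of Thm. 4.18 holds on the toy: `ℂ ⊗[ℚ] ℚ ≃ ℂ ≃ ⨁_{one class} ℂ`, equivariant for the
trivial group (every `g` is `1`). -/
theorem toyModel_directSum : Liu2021_Thm4_18_directSum (toyModel K c χEF) := by
  intro μ hμ
  haveI := toyIdxUnique K c χEF μ hμ
  haveI : Fintype {r : (toyModel K c χEF).Rep // ∃ t : Liu.OscillatorTriple K c χEF,
      t.μ = μ ∧ Liu.OscillatorTriple.IsAdmissible K t ∧ (toyModel K c χEF).osc t = r} := Fintype.ofFinite _
  let e₁ : (ℂ ⊗[(⊥ : IntermediateField ℚ ℂ)] (⊥ : IntermediateField ℚ ℂ)) ≃ₗ[ℂ] ℂ :=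
    (Algebra.TensorProduct.rid (⊥ : IntermediateField ℚ ℂ) ℂ ℂ).toLinearEquiv
  let e₂ : ℂ ≃ₗ[ℂ] ({r : (toyModel K c χEF).Rep // ∃ t : Liu.OscillatorTriple K c χEF,
      t.μ = μ ∧ Liu.OscillatorTriple.IsAdmissible K t ∧ (toyModel K c χEF).osc t = r} → ℂ) :=
    (LinearEquiv.funUnique _ ℂ ℂ).symm
  let e₃ := (DirectSum.linearEquivFunOnFintype ℂ
    {r : (toyModel K c χEF).Rep // ∃ t : Liu.OscillatorTriple K c χEF,
      t.μ = μ ∧ Liu.OscillatorTriple.IsAdmissible K t ∧ (toyModel K c χEF).osc t = r} (fun _ => ℂ)).symm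
  refine ⟨e₁.trans (e₂.trans e₃), fun g v => ?_⟩
  rw [Subsingleton.elim g (1 : Unit), map_one, map_one]
  rfl

/-- `M̃_μ = ℚ` is a number field on the toy. -/
theorem toyModel_numberField : Liu2021_p41_numberField (toyModel K c χEF) := fun _ _ =>
  show FiniteDimensional ℚ (⊥ : IntermediateField ℚ ℂ) from inferInstance

/-- The EIGHT displays consumed by B5's kernel theorems (`B5_main`, `B5_main_neat`, `B5_decomposition`, `B5_orbit`,
`B5_identity`, `nontrivial_HomQ_of_pos`) are jointly satisfiable on the toy, for every choice of the cell's Liu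
parameters (README §10.5(ii)(d)). -/
theorem exists_model2 : ∃ 𝓛 : LiuAlbaneseDatum K c χEF, ∃ h411 : Liu2021_Def4_11 𝓛,
    UllmoYafaev2014_neatInside 𝓛 ∧ Liu2021_Thm4_18_directSum 𝓛 ∧ Liu2021_p41_numberField 𝓛 ∧
    ∃ K₀ : OpenSubgroup 𝓛.G, IsCompact (K₀ : Set 𝓛.G) ∧
      Liu2021_Thm4_18_iso (shape 𝓛 h411 K₀) ∧ Liu2021_Thm4_18_1 (shape 𝓛 h411 K₀) ∧
      Liu2021_Cor4_20 (shape 𝓛 h411 K₀) ∧ Liu2021_Cor4_20_orbit (shape 𝓛 h411 K₀) :=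
  ⟨toyModel K c χEF, (toyModel_hypotheses K c χEF).1, (toyModel_hypotheses K c χEF).2,
    toyModel_directSum K c χEF, toyModel_numberField K c χEF, ⊤, by simp,
    (toyModel_B3_hypotheses K c χEF).1, (toyModel_B3_hypotheses K c χEF).2.1,
    (toyModel_B3_hypotheses K c χEF).2.2, toyModel_orbit K c χEF⟩

end Summit.Ventures.HodgeRepro2.T6.B5Toy2
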